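import Summits.NavierStokesRegularity.FluidComputer.PalasekTowerRegisterGlobalFloorsAtSlice
import Summits.NavierStokesRegularity.FluidComputer.PalasekTowerStageSmoothness
import Literature.Analysis.FluidPDE.NSTaoClassOfSobolevDatum

/-!
# REGISTER v2.3′: FREE RUNS FROM A REGISTERED SLICE ARE IN TAO'S CLASS — the boundedness clause of the
# slice form drops, and the UPPER stub `AprioriCeilingAt k` (`k ≥ 1`) is a property of the slice, hypothesis-free

Cell `ns-blowup`, seat `ns-blowup-ecbridge-7` (g5; literature-prover, D-0074 GROUP C «BRIDGE SUPPORT»;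
bears_on LADDER-NS N1, route `PalasekTowerBreakdown`, item stmt-NavierStokesRegularity-19249 `HeredityAtOne`,
registered line birth v3: stubs `stub_apriori_ceiling_at_one : AprioriCeilingAt 1` (upper) and the three floors).
Companion of `PalasekTowerRegisterGlobalFloorsAtSlice.lean` (ns-palasek-19249-p2, p459039: the free-run schema
`SliceRun`, `Stage.exists_continuation_of_freeRun` WITH a boundedness binder `hwB` on the free run, and
`readoutAt_iff_sliceRun` for the LOWER stubs, whose ceiling clause makes the run bounded by fiat), of
`PalasekTowerStageSmoothness.lean` (fc-prover-3: every registered stage is in Tao's class,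
`Stage.hasBoundedSobolevNormsOn`) and of the Literature theorem
`IsClassicalNSSolutionOn.hasBoundedSobolevNormsOn_of_restart` (`NSTaoClassOfSobolevDatum.lean`, this seat:
Tao 2013 Cor. 11.1 + Cor. 4.3 + Thm. 5.4 (iv) for an `H^∞` datum — a finite-energy classical solution started
from a SLICE of a Tao-class flow is Tao-class on its whole closed slab, no spatial decay of the slice needed).
LABEL: E–C typing (KERNEL: theorems only; no definition, no named fact, nothing asserted). WHAT THIS IS NOT: not
Navier–Stokes evidence — no stage, flow or tower is constructed and no stub is decided; the stubs appear only
inside equivalences and refutation templates.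

## What is proved

* §1 `Stage.freeRun_hasBoundedSobolevNormsOn` / `freeRun_exists_norm_le` / `freeRun_exists_norm_fderiv_le`: for a
  registered stage `s` at ANY level of ANY schedule (any rates, margin, `ν > 0`) and any time `t₀ ∈ [0, τ k]`, every
  classical finite-energy solution `(w, r)` of the UNFORCED system on a closed slab `[0, W]` with `w 0 = s.u t₀` is in
  Tao's class on `[0, W]`, hence BOUNDED there with a bounded gradient. (19249-p2's HANDOFF named this gap:
  «classical ≠ bounded in this tree». It is closed by Tao's Cor. 11.1 in `H^∞`-datum form: the slice `s.u t₀` has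
  all Sobolev norms finite because the stage is Tao-class, though it is not rapidly decaying.)
* §1 `Stage.exists_continuation_of_freeRun'`: p459039's `Stage.exists_continuation_of_freeRun` WITHOUT its binder
  `hwB : ∀ σ x, ‖w σ x‖ ≤ B` — every finite-energy free run from the slice `s.u (τ k)` of a stage of a quiet schedule
  (`k ≥ 1`) that continues locally across `τ k` IS the translate of a finite-energy classical continuation of `s`.
* §2 **`aprioriCeilingAt_iff_freeRunCeiling (1 ≤ k)`** (no hypothesis): `AprioriCeilingAt k ↔` for every pinned
  rigid quiet wide design, every registered level-`k` stage `s`, every horizon `W ∈ (0, τ (k+1) − τ k]` and every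
  finite-energy classical UNFORCED run `(w, r)` on `[0, W]` from the slice `w 0 = s.u (τ k)`:
  `‖w σ x‖ ≤ c₂ Y_{k+1}` on `[0, W] × ℝ³` — NO boundedness or tameness clause on the run. (⇒) the run is bounded
  (§1), glues onto the tree's local continuation of `s` (`localContinuationAt_of_forced_local_existence
  tao2011_smooth_local_existence_forced_holds`), and the ceiling applies to the glued continuation; (⇐) a
  continuation, translated to the origin `τ k`, is a free run (force silent from `τ 1 ≤ τ k` on), and before `τ k`
  the stage's own ceiling `c₂ Y_k ≤ c₂ Y_{k+1}` holds. First rung: `aprioriCeilingAt_one_iff_freeRunCeiling`.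
* §2 `not_aprioriCeilingAt_of_overshooting_freeRun`: the slice-form refutation template of the upper stub — ONE
  pinned rigid quiet wide design, ONE registered level-`k` stage, ONE finite-energy free run from its slice of
  length `≤` the window that exceeds `c₂ Y_{k+1}` somewhere refute `AprioriCeilingAt k` (mirror of p459039's
  `not_readoutAt_of_lazy_slice` for the floors).
* §3 `sliceRun_iff_of_aprioriCeilingAt`: under the upper stub the tameness clause of the LOWER stubs' schema is
  automatic on registered slices — `SliceRun S k P (s.u (τ k)) ↔` «every finite-energy free run over the window
  from the slice ends with `P`».

READING (item 19249, `k = 1`): all four registered stubs are now statements about the FREE unit-viscosity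
Navier–Stokes flow map on the set of registered level-1 slices over horizons `≤ W₁ = (253/25)·log N₂ / A₁`, with no
side condition on the competitor runs beyond «classical with finite energy» — the class in which Tao's
unconditional uniqueness (W14, a theorem of the tree) makes the run unique.

References: S. Palasek, arXiv:2605.13827 §4 [cite: Palasek2026ElementaryModel, §4]; T. Tao, Anal. PDE 6 (2013),
Cor. 11.1, Cor. 4.3, Thm. 5.4 (iv) [cite: Tao2011, Cor. 11.1 + Cor. 4.3 + Thm. 5.4 (iv) (arXiv Cor. 68, Cor. 26, Thm. 31 (iv))];
J. T. Beale, T. Kato, A. Majda, Comm. Math. Phys. 94 (1984) §1 [cite: BealeKatoMajda1984, §1].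
-/

noncomputable section

namespace Summit.NavierStokesRegularity.FluidComputer.PalasekTowerClayBridge

open Set MeasureTheory Filter Topology Function Real
open scoped ENNReal ContDiff NNReal
open Literature.Analysis.FluidPDE
open Summit.NavierStokesRegularity.NavierStokesRegularity

/-! ## §1 Free runs from a registered slice are in Tao's class -/

namespace Stage

variable {ν : ℝ} {R : TowerRates} {S : Schedule R} {m : Margins R} {k : ℕ}

/-- **A free run from a registered slice is in Tao's class.** Let `s` be a stage at level `k` (any rates, schedule,
margin; `ν > 0`), `t₀ ∈ [0, τ k]`, and `(w, r)` a classical solution of the UNFORCED system on `[0, W]`, `W > 0`,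
with `w 0 = s.u t₀` and finite energy there. Then `w ∈ L^∞_t H^n_x([0, W] × ℝ³)` for every `n`: the slice
`s.u t₀` has all Sobolev norms finite (`Stage.hasBoundedSobolevNormsOn`), and Tao's Cor. 11.1 in `H^∞`-datum form
(`IsClassicalNSSolutionOn.hasBoundedSobolevNormsOn_of_restart`) restarts from it.
[cite: Tao2011, Cor. 11.1 + Cor. 4.3 + Thm. 5.4 (iv) (arXiv Cor. 68, Cor. 26, Thm. 31 (iv))] -/
theorem freeRun_hasBoundedSobolevNormsOn (hν : 0 < ν) (s : Stage ν R S m k) {t₀ : ℝ}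
    (ht₀ : t₀ ∈ Icc 0 (S.τ k)) {W : ℝ} (hW : 0 < W)
    {w : ℝ → EuclideanSpace ℝ (Fin 3) → EuclideanSpace ℝ (Fin 3)} {r : ℝ → EuclideanSpace ℝ (Fin 3) → ℝ}
    (hw : IsClassicalNSSolutionOn (Icc 0 W) ν 0 w r) (hw0 : w 0 = s.u t₀)
    (hEw : ∃ C : ℝ≥0∞, C < ⊤ ∧ ∀ σ ∈ Icc 0 W, ∫⁻ x, ‖w σ x‖ₑ ^ 2 ≤ C) :
    HasBoundedSobolevNormsOn (Icc 0 W) w := by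
  have hE' : ∃ C : ℝ≥0, ∀ σ ∈ Icc 0 W, ∫⁻ x, ‖w σ x‖ₑ ^ 2 ≤ C := by
    obtain ⟨C, hC, hb⟩ := hEw
    exact ⟨C.toNNReal, fun σ hσ => (hb σ hσ).trans (ENNReal.coe_toNNReal hC.ne).ge⟩
  exact hw.hasBoundedSobolevNormsOn_of_restart (s.hasBoundedSobolevNormsOn hν) ht₀ hν hW hE' hw0
    fun m => ⟨0, fun t _ => by simp⟩

/-- **A free run from a registered slice is BOUNDED on its closed slab, with a bounded gradient** (same
hypotheses). A classical solution in the tree's sense is smooth but not a priori bounded in space; started from a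
registered slice with finite energy it is.
[cite: Tao2011, Cor. 11.1 (arXiv Cor. 68)] -/
theorem freeRun_exists_norm_le (hν : 0 < ν) (s : Stage ν R S m k) {t₀ : ℝ}
    (ht₀ : t₀ ∈ Icc 0 (S.τ k)) {W : ℝ} (hW : 0 < W)
    {w : ℝ → EuclideanSpace ℝ (Fin 3) → EuclideanSpace ℝ (Fin 3)} {r : ℝ → EuclideanSpace ℝ (Fin 3) → ℝ}
    (hw : IsClassicalNSSolutionOn (Icc 0 W) ν 0 w r) (hw0 : w 0 = s.u t₀)
    (hEw : ∃ C : ℝ≥0∞, C < ⊤ ∧ ∀ σ ∈ Icc 0 W, ∫⁻ x, ‖w σ x‖ₑ ^ 2 ≤ C) :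
    (∃ B : ℝ, 0 ≤ B ∧ ∀ σ ∈ Icc 0 W, ∀ x, ‖w σ x‖ ≤ B) ∧
      ∃ B : ℝ, 0 ≤ B ∧ ∀ σ ∈ Icc 0 W, ∀ x, ‖fderiv ℝ (w σ) x‖ ≤ B := by
  have hE' : ∃ C : ℝ≥0, ∀ σ ∈ Icc 0 W, ∫⁻ x, ‖w σ x‖ₑ ^ 2 ≤ C := by
    obtain ⟨C, hC, hb⟩ := hEw
    exact ⟨C.toNNReal, fun σ hσ => (hb σ hσ).trans (ENNReal.coe_toNNReal hC.ne).ge⟩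
  exact (hw.exists_norm_le_of_restart_unforced (s.hasBoundedSobolevNormsOn hν) ht₀ hν hW hE' hw0).2

/-- **`Stage.exists_continuation_of_freeRun` WITHOUT the boundedness binder** (quiet schedule, `k ≥ 1`, `ν > 0`,
any rates and margin). Let `s` be a stage at level `k` admitting SOME classical finite-energy continuation under the
design force to a time `T₁ > τ k`, and let `(w, r)` be an UNFORCED classical solution on `[0, W]`, `W > 0`, from
the slice `w 0 = s.u (τ k)`, of finite energy. Then there is a classical finite-energy continuation `(u, p)` of `s`
on `[0, τ k + W]` under the design force, agreeing with `s` in velocity and pressure on `[0, τ k]`, whose translate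
is `w`: `u (σ + τ k) = w σ` on `[0, W]`. (The run is bounded by `freeRun_exists_norm_le`; then p459039's theorem.)
[cite: Tao2011, Cor. 11.1 (arXiv Cor. 68)] [cite: BealeKatoMajda1984, §1] -/
theorem exists_continuation_of_freeRun' (hν : 0 < ν) (hQ : S.Quiet) (hk : 1 ≤ k) (s : Stage ν R S m k)
    (hloc : ∃ T₁ : ℝ, S.τ k < T₁ ∧
      ∃ (u₁ : ℝ → EuclideanSpace ℝ (Fin 3) → EuclideanSpace ℝ (Fin 3)) (p₁ : ℝ → EuclideanSpace ℝ (Fin 3) → ℝ),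
        IsClassicalNSSolutionOn (Icc 0 T₁) ν S.f u₁ p₁ ∧
        (∀ t ∈ Icc 0 (S.τ k), u₁ t = s.u t ∧ p₁ t = s.p t) ∧
        (∃ C : ℝ≥0∞, C < ⊤ ∧ ∀ t ∈ Icc 0 T₁, ∫⁻ x, ‖u₁ t x‖ₑ ^ 2 ≤ C))
    {W : ℝ} (hW : 0 < W)
    {w : ℝ → EuclideanSpace ℝ (Fin 3) → EuclideanSpace ℝ (Fin 3)} {r : ℝ → EuclideanSpace ℝ (Fin 3) → ℝ}
    (hw : IsClassicalNSSolutionOn (Icc 0 W) ν 0 w r) (hw0 : w 0 = s.u (S.τ k))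
    (hEw : ∃ C : ℝ≥0∞, C < ⊤ ∧ ∀ σ ∈ Icc 0 W, ∫⁻ x, ‖w σ x‖ₑ ^ 2 ≤ C) :
    ∃ (u : ℝ → EuclideanSpace ℝ (Fin 3) → EuclideanSpace ℝ (Fin 3)) (p : ℝ → EuclideanSpace ℝ (Fin 3) → ℝ),
      IsClassicalNSSolutionOn (Icc 0 (S.τ k + W)) ν S.f u p ∧
      (∀ t ∈ Icc 0 (S.τ k), u t = s.u t ∧ p t = s.p t) ∧
      (∃ C : ℝ≥0∞, C < ⊤ ∧ ∀ t ∈ Icc 0 (S.τ k + W), ∫⁻ x, ‖u t x‖ₑ ^ 2 ≤ C) ∧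
      ∀ σ ∈ Icc 0 W, u (σ + S.τ k) = w σ := by
  obtain ⟨⟨B, -, hB⟩, -⟩ := s.freeRun_exists_norm_le hν ⟨(S.τ_pos k).le, le_rfl⟩ hW hw hw0 hEw
  exact s.exists_continuation_of_freeRun hν hQ hk hloc hW hw hw0 hEw hB

/-- **A continuation of a stage, translated to the origin `τ k`, is a free run on `[0, T' − τ k]`** (quiet
schedule, `k ≥ 1`, any horizon `T' > τ k`; p459039's `freeRun_of_continuation` is the case `T' = τ (k+1)`).
[cite: BealeKatoMajda1984, §1] -/
theorem freeRun_of_continuation' (hQ : S.Quiet) (hk : 1 ≤ k) (s : Stage ν R S m k) {T' : ℝ}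
    (hT' : S.τ k < T') {u : ℝ → EuclideanSpace ℝ (Fin 3) → EuclideanSpace ℝ (Fin 3)}
    {p : ℝ → EuclideanSpace ℝ (Fin 3) → ℝ} (hcl : IsClassicalNSSolutionOn (Icc 0 T') ν S.f u p) :
    IsClassicalNSSolutionOn (Icc 0 (T' - S.τ k)) ν 0 (fun σ => u (σ + S.τ k))
      (fun σ => p (σ + S.τ k)) := by
  have _ := s
  have hpre : Icc 0 (T' - S.τ k) ⊆ (fun σ => σ + S.τ k) ⁻¹' Icc 0 T' := by
    intro σ hσ
    simp only [mem_preimage, mem_Icc] at hσ ⊢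
    constructor <;> linarith [hσ.1, hσ.2, (S.τ_pos k).le]
  refine ((hcl.comp_add_right (S.τ k)).mono hpre (uniqueDiffOn_Icc (by linarith))).congr_force
    fun σ hσ x => ?_
  have h0 : S.f (σ + S.τ k) = 0 := hQ (σ + S.τ k) (by linarith [hσ.1, S.τ_mono hk])
  simp [h0]

end Stage

/-! ## §2 The upper stub is a property of the slice — no boundedness clause -/

/-- **`AprioriCeilingAt k` ⇔ the FREE-RUN CEILING on every registered level-`k` slice** (`k ≥ 1`, NO hypothesis,
NO tameness clause on the runs): every finite-energy classical continuation of every registered level-`k` stage of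
a pinned rigid quiet wide design to any `T' ∈ [τ k, τ (k+1)]` stays inside `c₂ Y_{k+1}` on `[0, T'] × ℝ³` iff for
every such stage `s`, every horizon `W ∈ (0, τ (k+1) − τ k]` and every classical finite-energy solution `(w, r)` of
the UNFORCED unit-viscosity system on `[0, W]` with `w 0 = s.u (τ k)`, `‖w σ x‖ ≤ c₂ Y_{k+1}` on `[0, W] × ℝ³`.
(⇒) the run is bounded (`Stage.freeRun_exists_norm_le`, Tao's class), so it glues onto the tree's local
continuation of the stage (`Stage.exists_continuation_of_freeRun'`,
`localContinuationAt_of_forced_local_existence tao2011_smooth_local_existence_forced_holds`) and the ceiling of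
the glued continuation is the bound; (⇐) translate a continuation to the origin `τ k`
(`Stage.freeRun_of_continuation'`); before `τ k` the stage's ceiling `c₂ Y_k ≤ c₂ Y_{k+1}` holds.
[cite: Palasek2026ElementaryModel, §4] -/
theorem aprioriCeilingAt_iff_freeRunCeiling {k : ℕ} (hk : 1 ≤ k) :
    AprioriCeilingAt k ↔
      ∀ S : Schedule TowerRates.wide, S.Pins 8 (6 / 5) → S.Rigid → S.Quiet →
        ∀ s : Stage 1 TowerRates.wide S (Margins.routeG TowerRates.wide) k,
        ∀ W ∈ Ioc 0 (S.τ (k + 1) - S.τ k),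
        ∀ (w : ℝ → EuclideanSpace ℝ (Fin 3) → EuclideanSpace ℝ (Fin 3))
          (r : ℝ → EuclideanSpace ℝ (Fin 3) → ℝ),
          IsClassicalNSSolutionOn (Icc 0 W) 1 0 w r → w 0 = s.u (S.τ k) →
          (∃ C : ℝ≥0∞, C < ⊤ ∧ ∀ σ ∈ Icc 0 W, ∫⁻ x, ‖w σ x‖ₑ ^ 2 ≤ C) →
          ∀ σ ∈ Icc 0 W, ∀ x, ‖w σ x‖ ≤ S.c₂ * TowerRates.wide.Y (k + 1) := by
  constructor
  · intro h S hP hR hQ s W hWI w r hw hw0 hEw σ hσ x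
    have hW : 0 < W := hWI.1
    have hloc := localContinuationAt_of_forced_local_existence tao2011_smooth_local_existence_forced_holds k
      S hP hR hQ s
    obtain ⟨u, p, hcl, hagree, hE, hshift⟩ :=
      s.exists_continuation_of_freeRun' one_pos hQ hk hloc hW hw hw0 hEw
    have hT' : S.τ k + W ∈ Icc (S.τ k) (S.τ (k + 1)) := ⟨by linarith, by linarith [hWI.2]⟩
    have hb := h S hP hR hQ s (S.τ k + W) hT' u p hcl hagree hE (σ + S.τ k)
      ⟨by linarith [hσ.1, (S.τ_pos k).le], by linarith [hσ.2]⟩ x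
    rwa [hshift σ hσ] at hb
  · intro h S hP hR hQ s T' hT' u p hcl hagree hE t ht x
    rcases le_or_gt t (S.τ k) with htk | htk
    · rw [(hagree t ⟨ht.1, htk⟩).1]
      exact (s.ceiling k le_rfl t ⟨ht.1, htk⟩ x).trans
        (mul_le_mul_of_nonneg_left (TowerRates.wide.Y_le_Y_succ k) s.c₂_pos.le)
    · have hT'k : S.τ k < T' := lt_of_lt_of_le htk ht.2
      have hWI : T' - S.τ k ∈ Ioc 0 (S.τ (k + 1) - S.τ k) := ⟨by linarith, by linarith [hT'.2]⟩
      have hw := s.freeRun_of_continuation' hQ hk hT'k hcl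
      have hw0 : (fun σ => u (σ + S.τ k)) 0 = s.u (S.τ k) := by
        show u (0 + S.τ k) = s.u (S.τ k)
        rw [zero_add]
        exact (hagree (S.τ k) ⟨(S.τ_pos k).le, le_rfl⟩).1
      have hEw : ∃ C : ℝ≥0∞, C < ⊤ ∧ ∀ σ ∈ Icc 0 (T' - S.τ k),
          ∫⁻ x, ‖(fun σ => u (σ + S.τ k)) σ x‖ₑ ^ 2 ≤ C := by
        obtain ⟨C, hC, hb⟩ := hE
        exact ⟨C, hC, fun σ hσ => hb _ ⟨by linarith [hσ.1, (S.τ_pos k).le], by linarith [hσ.2]⟩⟩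
      have hb := h S hP hR hQ s (T' - S.τ k) hWI _ _ hw hw0 hEw (t - S.τ k)
        ⟨by linarith, by linarith [ht.2]⟩ x
      simpa only [sub_add_cancel] using hb

/-- **THE FIRST RUNG (item 19249): the upper stub `AprioriCeilingAt 1` is a property of the level-1 slice** —
every finite-energy free unit-viscosity Navier–Stokes run of length `≤ τ₂ − τ₁` from every registered level-1 slice
stays inside `c₂ Y₂`; no boundedness clause, no hypothesis. [cite: Palasek2026ElementaryModel, §4] -/
theorem aprioriCeilingAt_one_iff_freeRunCeiling :
    AprioriCeilingAt 1 ↔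
      ∀ S : Schedule TowerRates.wide, S.Pins 8 (6 / 5) → S.Rigid → S.Quiet →
        ∀ s : Stage 1 TowerRates.wide S (Margins.routeG TowerRates.wide) 1,
        ∀ W ∈ Ioc 0 (S.τ 2 - S.τ 1),
        ∀ (w : ℝ → EuclideanSpace ℝ (Fin 3) → EuclideanSpace ℝ (Fin 3))
          (r : ℝ → EuclideanSpace ℝ (Fin 3) → ℝ),
          IsClassicalNSSolutionOn (Icc 0 W) 1 0 w r → w 0 = s.u (S.τ 1) →
          (∃ C : ℝ≥0∞, C < ⊤ ∧ ∀ σ ∈ Icc 0 W, ∫⁻ x, ‖w σ x‖ₑ ^ 2 ≤ C) →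
          ∀ σ ∈ Icc 0 W, ∀ x, ‖w σ x‖ ≤ S.c₂ * TowerRates.wide.Y 2 :=
  aprioriCeilingAt_iff_freeRunCeiling le_rfl

/-- **Refutation template for the upper stub, slice form** (`k ≥ 1`): ONE pinned rigid quiet wide design, ONE
registered level-`k` stage, ONE finite-energy classical free run from its slice `s.u (τ k)` of length `W ≤` the
window and ONE point `(σ, x)` of the run with speed `> c₂ Y_{k+1}` refute `AprioriCeilingAt k`. No boundedness of
the run is asked (it is automatic). [cite: Palasek2026ElementaryModel, §4] -/
theorem not_aprioriCeilingAt_of_overshooting_freeRun {k : ℕ} (hk : 1 ≤ k)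
    (S : Schedule TowerRates.wide) (hP : S.Pins 8 (6 / 5)) (hR : S.Rigid) (hQ : S.Quiet)
    (s : Stage 1 TowerRates.wide S (Margins.routeG TowerRates.wide) k)
    {W : ℝ} (hW : W ∈ Ioc 0 (S.τ (k + 1) - S.τ k))
    {w : ℝ → EuclideanSpace ℝ (Fin 3) → EuclideanSpace ℝ (Fin 3)} {r : ℝ → EuclideanSpace ℝ (Fin 3) → ℝ}
    (hw : IsClassicalNSSolutionOn (Icc 0 W) 1 0 w r) (hw0 : w 0 = s.u (S.τ k))
    (hEw : ∃ C : ℝ≥0∞, C < ⊤ ∧ ∀ σ ∈ Icc 0 W, ∫⁻ x, ‖w σ x‖ₑ ^ 2 ≤ C)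
    (hover : ∃ σ ∈ Icc 0 W, ∃ x, S.c₂ * TowerRates.wide.Y (k + 1) < ‖w σ x‖) :
    ¬ AprioriCeilingAt k := by
  intro hA
  obtain ⟨σ, hσ, x, hx⟩ := hover
  exact absurd ((aprioriCeilingAt_iff_freeRunCeiling hk).1 hA S hP hR hQ s W hW w r hw hw0 hEw σ hσ x)
    (not_le.2 hx)

/-! ## §3 Under the upper stub the tameness clause of the lower stubs' schema is automatic -/

/-- **Under `AprioriCeilingAt k` the free-run schema needs no ceiling clause on registered slices** (`k ≥ 1`): for
a registered level-`k` stage `s` of a pinned rigid quiet wide design, `SliceRun S k P (s.u (τ k))` (every TAME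
finite-energy free run over the window from the slice ends with `P`) is equivalent to «EVERY finite-energy
classical free run over the window from the slice ends with `P`» — the ceiling `c₂ Y_{k+1}` of any such run is
supplied by the upper stub in slice form. [cite: Palasek2026ElementaryModel, §4] -/
theorem sliceRun_iff_of_aprioriCeilingAt {k : ℕ} (hk : 1 ≤ k) (hA : AprioriCeilingAt k)
    {P : Schedule TowerRates.wide → (EuclideanSpace ℝ (Fin 3) → EuclideanSpace ℝ (Fin 3)) → Prop}
    (S : Schedule TowerRates.wide) (hP : S.Pins 8 (6 / 5)) (hR : S.Rigid) (hQ : S.Quiet)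
    (s : Stage 1 TowerRates.wide S (Margins.routeG TowerRates.wide) k) :
    SliceRun S k P (s.u (S.τ k)) ↔
      ∀ (w : ℝ → EuclideanSpace ℝ (Fin 3) → EuclideanSpace ℝ (Fin 3))
        (r : ℝ → EuclideanSpace ℝ (Fin 3) → ℝ),
        IsClassicalNSSolutionOn (Icc 0 (S.τ (k + 1) - S.τ k)) 1 0 w r →
        w 0 = s.u (S.τ k) →
        (∃ C : ℝ≥0∞, C < ⊤ ∧ ∀ σ ∈ Icc 0 (S.τ (k + 1) - S.τ k), ∫⁻ x, ‖w σ x‖ₑ ^ 2 ≤ C) →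
        P S (w (S.τ (k + 1) - S.τ k)) := by
  have hW : 0 < S.τ (k + 1) - S.τ k := by linarith [S.τ_lt_succ k]
  constructor
  · intro h w r hw hw0 hEw
    exact h w r hw hw0 hEw ((aprioriCeilingAt_iff_freeRunCeiling hk).1 hA S hP hR hQ s _ ⟨hW, le_rfl⟩
      w r hw hw0 hEw)
  · intro h w r hw hw0 hEw _
    exact h w r hw hw0 hEw

end Summit.NavierStokesRegularity.FluidComputer.PalasekTowerClayBridge

end
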